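import Summits.HodgeConjecture.HodgeConjecture.Theorems.LinearSystemTorelliTranscendentalOrSupportedStubCompletelyReducible
import Literature.AlgebraicGeometry.HodgeTheory.HodgeRiemannPolarizabilityProofs
import Literature.AlgebraicGeometry.HodgeTheory.SupportedClassesRationalProofs
import Literature.AlgebraicGeometry.HodgeTheory.AlgebraicClassesHodgeTypeHolds
import Literature.AlgebraicGeometry.HodgeTheory.HodgeFiltrationModelsReductionProofs
import Literature.AlgebraicGeometry.HodgeTheory.ComplexGysinHodgeType
import Literature.Barriers.HodgeConjecture.GeneralizedHodgeTrivialReasonsParity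

/-!
# Crux `TranscendentalOrSupported` (stmt-HodgeConjecture-10853), line `Sketch_chow_shadow` — stub
# `stub_isotypicAlg`: the isotypic lemma (an image inside `T(X) + Algᵖ(X)` without
# `(2p,0)`-part is algebraic)

Helper file for the line skeleton `Sketch_chow_shadow` (cohomological transcendental decomposition
of the diagonal) of the crux `TranscendentalOrSupported` of route `LinearSystemTorelli`, registered
stub `stub_isotypicAlg`. Notation: `X` smooth projective of dimension `2p` over `ℂ` (`p ≥ 1`), `A` a
Hodge model of `X` (`A^* = A.pullback k : Hᵏ(X(ℂ); ℂ) → Hᵏ(X^an; ℂ)` the bijective comparison,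
`H^{a,d} = A.hodgePQ k a d` the pieces of the model), `k = 2p`, `Alg = algebraicClasses X p =
Nᵖ H²ᵖ(X(ℂ); ℂ)`. A complex subspace `V ⊆ Hᵏ(X(ℂ); ℂ)` is *rationally spanned* if
`span ℂ {x ∈ V | IsRationalClass x} = V`, and *sub-Hodge (read in `A`)* if
`V.map A^* = ⨆_{a+d=k} V.map A^* ⊓ H^{a,d}`.

CLAIM (`stub_isotypicAlg`). Let `f` be an endomorphism of `H²ᵖ(X(ℂ); ℂ)` with `im f ≤ V` for EVERY
rationally spanned sub-Hodge `V` with `H^{2p,0} ≤ V.map A^*` and `Alg ≤ V` (definition-free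
spelling of `im f ⊆ T(X) + Alg`, `T(X)` the transcendental part), and let `W` be a subspace with
`f(W) ≤ M` for a rationally spanned sub-Hodge `M` with `M.map A^* ⊓ H^{2p,0} = 0`. Then
`f(W) ≤ Alg`.

PROOF (Voisin I, §7.3.1, Lemma 7.26: semisimplicity of polarizable Hodge structures, in the form
of the landed `stub_completelyReducible`).
* `Alg` is rationally spanned (`supportedClasses_eq_span_isRationalClass`), of pure type `(p, p)`
  (`isOfHodgeType_of_mem_algebraicClasses_of_isSmoothProjective`, read in the fixed model `A` by
  `hodgePQ_independent_of_hodgeModel_holds`), hence sub-Hodge and without `(2p,0)`-part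
  (`H^{p,p} ∩ H^{2p,0} = 0` for `p ≥ 1`, `HodgeModel.iSupIndep_hodgePQ`).
* Rationally spanned and sub-Hodge are stable under `⊔` (`isotypicAlg_rat_sup`,
  `isotypicAlg_sub_sup`), and the `(a,d)`-part of `(V₁ ⊔ V₂).map A^*` lies in the sum of the
  `(a,d)`-parts of `V₁.map A^*` and `V₂.map A^*` (`isotypicAlg_map_sup_inf_le`: the Hodge
  components of a class of a sub-Hodge subspace lie in it, `perpSubHodge_component_mem`, and the
  decomposition into types is unique, `perpSubHodge_hodgeComponents_unique`). So `M₁ := M ⊔ Alg`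
  is rationally spanned, sub-Hodge, without `(2p,0)`-part.
* `⊤` is rationally spanned (`span_isRationalClass_eq_top_of_isSmoothProjective_holds`) and
  sub-Hodge (`A^*` is surjective and `HodgeModel.isSubHodge_top`), so complete reducibility
  (`stub_completelyReducible` with `smoothProjective_hodgeStructure_isPolarizable_holds`) gives a
  rationally spanned sub-Hodge `M₁'` with `M₁ ⊓ M₁' = 0`, `M₁ ⊔ M₁' = ⊤`; by
  `isotypicAlg_map_sup_inf_le` again, `H^{2p,0} = (M₁ ⊔ M₁').map A^* ⊓ H^{2p,0} ≤
  0 ⊔ M₁'.map A^* ⊓ H^{2p,0}`, i.e. `H^{2p,0} ≤ M₁'.map A^*`.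
* `V := M₁' ⊔ Alg` qualifies, so `im f ≤ V`; for `w ∈ W`, `f w = m' + a` with `m' ∈ M₁'`,
  `a ∈ Alg`, and `m' = f w - a ∈ M₁ ⊓ M₁' = 0`, whence `f w = a ∈ Alg`.

Pure tree theorems; no named fact is taken as a hypothesis and none is introduced.

References: C. Voisin, *Hodge Theory and Complex Algebraic Geometry I* (CUP 2002), §7.1.1, §7.3.1
(Lemma 7.25, Lemma 7.26 and the remark after it), §11.1.2 Prop. 11.20; C. Voisin, *Hodge and
generalized Hodge conjectures, coniveau and algebraic cycles*, J. Open Math. Probl. 1 (2025),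
Prop. 2.11.
-/

-- `Summit.HodgeConjecture.HodgeConjecture.Theorems` is the mandated namespace (single-conjunct
-- summit: Sub = Summit), which `linter.dupNamespace` flags on every declaration; the lakefile turns
-- the linter off tree-wide (weak option), restated here so stand-alone elaboration is warning-free.
set_option linter.dupNamespace false

noncomputable section

namespace Summit.HodgeConjecture.HodgeConjecture.Theorems

open CategoryTheory
open Literature.AlgebraicGeometry.Motives Literature.AlgebraicGeometry.HodgeTheory
open Literature.AlgebraicTopology.SingularHomology
-- `Finset.antidiagonal` alone resolves to the `Set.IsPWO` antidiagonal of
-- `Data.Finset.MulAntidiagonal`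
open Finset.HasAntidiagonal (antidiagonal mem_antidiagonal)

variable {n : ℕ} {X : SchemeOver ℂ}

/-! ### Sums of rationally spanned sub-Hodge subspaces -/

/-- **The sum of two rationally spanned subspaces is rationally spanned**: if
`Vᵢ = span ℂ {x ∈ Vᵢ | x rational}` for `i = 1, 2`, then `V₁ ⊔ V₂` is the span of its rational
classes (each `Vᵢ` is spanned by rational classes of `V₁ ⊔ V₂`). [cite: VoisinHodgeI2002, §7.1.1] -/
theorem isotypicAlg_rat_sup {k : ℕ} {V₁ V₂ : Submodule ℂ (complexBetti X k)}
    (h₁ : Submodule.span ℂ {x : complexBetti X k | x ∈ V₁ ∧ IsRationalClass x} = V₁)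
    (h₂ : Submodule.span ℂ {x : complexBetti X k | x ∈ V₂ ∧ IsRationalClass x} = V₂) :
    Submodule.span ℂ {x : complexBetti X k | x ∈ V₁ ⊔ V₂ ∧ IsRationalClass x} = V₁ ⊔ V₂ := by
  refine le_antisymm (Submodule.span_le.2 fun x hx ↦ hx.1) (sup_le ?_ ?_)
  · exact h₁.ge.trans (Submodule.span_mono fun x hx ↦ ⟨Submodule.mem_sup_left hx.1, hx.2⟩)
  · exact h₂.ge.trans (Submodule.span_mono fun x hx ↦ ⟨Submodule.mem_sup_right hx.1, hx.2⟩)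

/-- **The sum of two sub-Hodge subspaces read in `A` is one**: if `Vᵢ.map A^*` is the supremum of
its intersections with the `H^{p',q'}` (`i = 1, 2`), so is `(V₁ ⊔ V₂).map A^* =
V₁.map A^* ⊔ V₂.map A^*` (only `≤` is content, `HodgeModel.isSubHodge_iff_le`; monotonicity).
[cite: VoisinHodgeI2002, §7.3.1 (remark after Lemma 7.26)] -/
theorem isotypicAlg_sub_sup (A : HodgeModel n X) {k : ℕ} {V₁ V₂ : Submodule ℂ (complexBetti X k)}
    (h₁ : V₁.map (A.pullback k).hom =
      ⨆ (p' : ℕ) (q' : ℕ) (_ : p' + q' = k), V₁.map (A.pullback k).hom ⊓ A.hodgePQ k p' q')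
    (h₂ : V₂.map (A.pullback k).hom =
      ⨆ (p' : ℕ) (q' : ℕ) (_ : p' + q' = k), V₂.map (A.pullback k).hom ⊓ A.hodgePQ k p' q') :
    (V₁ ⊔ V₂).map (A.pullback k).hom =
      ⨆ (p' : ℕ) (q' : ℕ) (_ : p' + q' = k),
        (V₁ ⊔ V₂).map (A.pullback k).hom ⊓ A.hodgePQ k p' q' := by
  refine (A.isSubHodge_iff_le k _).2 ?_
  rw [Submodule.map_sup]
  refine sup_le (h₁.le.trans ?_) (h₂.le.trans ?_)
  · exact iSup_mono fun _ ↦ iSup_mono fun _ ↦ iSup_mono fun _ ↦ inf_le_inf_right _ le_sup_left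
  · exact iSup_mono fun _ ↦ iSup_mono fun _ ↦ iSup_mono fun _ ↦ inf_le_inf_right _ le_sup_right

/-- **The `(a,d)`-part of a sum of two sub-Hodge subspaces**: for sub-Hodge subspaces `V₁, V₂`
read in `A` and `a + d = k`, `(V₁ ⊔ V₂).map A^* ⊓ H^{a,d} ≤ V₁.map A^* ⊓ H^{a,d} ⊔
V₂.map A^* ⊓ H^{a,d}`. Indeed for `y = A^*(v₁ + v₂)` of pure type `(a, d)`, decompose `v₁`, `v₂`
into Hodge components `z₁(i) ∈ V₁`, `z₂(i) ∈ V₂` (`HodgeModel.exists_sum_eq_of_hodgeDecomposition`,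
`perpSubHodge_component_mem`); then `y = Σᵢ A^*(z₁ i) + A^*(z₂ i)` and `y` is its own
`(a,d)`-component, so `y = A^* z₁(a,d) + A^* z₂(a,d)` by uniqueness of the decomposition into types
(`perpSubHodge_hodgeComponents_unique`). [cite: VoisinHodgeI2002, §7.3.1 (Lemma 7.25)] -/
theorem isotypicAlg_map_sup_inf_le (A : HodgeModel n X) {k : ℕ}
    {V₁ V₂ : Submodule ℂ (complexBetti X k)}
    (h₁ : V₁.map (A.pullback k).hom =
      ⨆ (p' : ℕ) (q' : ℕ) (_ : p' + q' = k), V₁.map (A.pullback k).hom ⊓ A.hodgePQ k p' q')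
    (h₂ : V₂.map (A.pullback k).hom =
      ⨆ (p' : ℕ) (q' : ℕ) (_ : p' + q' = k), V₂.map (A.pullback k).hom ⊓ A.hodgePQ k p' q')
    {a d : ℕ} (had : a + d = k) :
    (V₁ ⊔ V₂).map (A.pullback k).hom ⊓ A.hodgePQ k a d ≤
      V₁.map (A.pullback k).hom ⊓ A.hodgePQ k a d ⊔
        V₂.map (A.pullback k).hom ⊓ A.hodgePQ k a d := by
  rintro _ ⟨⟨v, hv, rfl⟩, hy⟩
  obtain ⟨v₁, hv₁, v₂, hv₂, rfl⟩ := Submodule.mem_sup.1 hv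
  -- the Hodge components of `v₁` and `v₂` lie in `V₁` and `V₂`
  obtain ⟨z₁, hz₁, hz₁t⟩ := A.exists_sum_eq_of_hodgeDecomposition k v₁
  obtain ⟨z₂, hz₂, hz₂t⟩ := A.exists_sum_eq_of_hodgeDecomposition k v₂
  have hz₁V := perpSubHodge_component_mem A h₁ hv₁ hz₁ hz₁t
  have hz₂V := perpSubHodge_component_mem A h₂ hv₂ hz₂ hz₂t
  have hi : (a, d) ∈ antidiagonal k := mem_antidiagonal.2 had
  -- two decompositions of `A^* (v₁ + v₂)` into types
  have hsum : ∑ i ∈ antidiagonal k, (A.pullback k (z₁ i) + A.pullback k (z₂ i)) =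
      ∑ i ∈ antidiagonal k, (if i = (a, d) then (A.pullback k).hom (v₁ + v₂) else 0) := by
    rw [Finset.sum_ite_eq' (antidiagonal k) (a, d), if_pos hi, Finset.sum_add_distrib]
    change ∑ i ∈ antidiagonal k, (A.pullback k).hom (z₁ i) +
      ∑ i ∈ antidiagonal k, (A.pullback k).hom (z₂ i) = _
    rw [← map_sum, ← map_sum, hz₁, hz₂, map_add]
  have hw : ∀ i ∈ antidiagonal k,
      (if i = (a, d) then (A.pullback k).hom (v₁ + v₂) else 0) ∈ A.hodgePQ k i.1 i.2 := by
    intro i _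
    split_ifs with h
    · subst h
      exact hy
    · exact Submodule.zero_mem _
  have heq := perpSubHodge_hodgeComponents_unique A k
    (v := fun i ↦ A.pullback k (z₁ i) + A.pullback k (z₂ i))
    (w := fun i ↦ if i = (a, d) then (A.pullback k).hom (v₁ + v₂) else 0)
    (fun i hi' ↦ Submodule.add_mem _ (hz₁t i hi') (hz₂t i hi')) hw hsum (a, d) hi
  have key : (A.pullback k).hom (v₁ + v₂) =
      A.pullback k (z₁ (a, d)) + A.pullback k (z₂ (a, d)) := by
    rw [heq, if_pos rfl]
  rw [key]
  exact Submodule.add_mem_sup ⟨Submodule.mem_map_of_mem (hz₁V (a, d) hi), hz₁t (a, d) hi⟩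
    ⟨Submodule.mem_map_of_mem (hz₂V (a, d) hi), hz₂t (a, d) hi⟩

/-! ### The stub -/

/-- **STUB `stub_isotypicAlg` (the isotypic lemma) of the crux `TranscendentalOrSupported`, line
`Sketch_chow_shadow`.** For `p ≥ 1`, `X` smooth projective of dimension `2p`, a Hodge model `A`, an
endomorphism `f` of `H²ᵖ(X(ℂ); ℂ)` whose image lies in every rationally spanned sub-Hodge `V` with
`H^{2p,0} ≤ V.map A^*` and `Algᵖ(X) ≤ V` (i.e. `im f ⊆ T(X) + Algᵖ(X)`), and a subspace `W` with
`f(W) ≤ M`, `M` rationally spanned, sub-Hodge and without `(2p,0)`-part: `f(W) ≤ Algᵖ(X)`.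
Proof: `M₁ := M ⊔ Algᵖ(X)` is rationally spanned (`supportedClasses_eq_span_isRationalClass`,
`isotypicAlg_rat_sup`), sub-Hodge (algebraic classes are of type `(p, p)`,
`isOfHodgeType_of_mem_algebraicClasses_of_isSmoothProjective`; `isotypicAlg_sub_sup`) and without
`(2p,0)`-part (`isotypicAlg_map_sup_inf_le`, `H^{p,p} ∩ H^{2p,0} = 0` as `p ≥ 1`); complete
reducibility (`stub_completelyReducible` with `smoothProjective_hodgeStructure_isPolarizable_holds`)
inside the rationally spanned (`span_isRationalClass_eq_top_of_isSmoothProjective_holds`) sub-Hodge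
`⊤` yields a rationally spanned sub-Hodge complement `M₁'` (`M₁ ⊓ M₁' = 0`, `M₁ ⊔ M₁' = ⊤`), and
`H^{2p,0} ≤ M₁'.map A^*` (`isotypicAlg_map_sup_inf_le`); so `V := M₁' ⊔ Algᵖ(X)` qualifies,
`f w = m' + a` with `m' ∈ M₁'`, `a ∈ Algᵖ(X)`, and `m' = f w - a ∈ M₁ ⊓ M₁' = 0`.
[cite: VoisinHodgeI2002, §7.3.1 Lemma 7.26] [cite: Voisin2025, Prop. 2.11] -/
theorem stub_isotypicAlg :
    ∀ ⦃p : ℕ⦄ ⦃X : SchemeOver ℂ⦄, 1 ≤ p → ∀ (hX : IsSmoothProjective (2 * p) X)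
    (A : HodgeModel (2 * p) X) (f : complexBetti X (2 * p) →ₗ[ℂ] complexBetti X (2 * p))
    (W M : Submodule ℂ (complexBetti X (2 * p))),
    Submodule.span ℂ {x : complexBetti X (2 * p) | x ∈ M ∧ IsRationalClass x} = M →
    M.map (A.pullback (2 * p)).hom =
      ⨆ (p' : ℕ) (q' : ℕ) (_ : p' + q' = 2 * p), M.map (A.pullback (2 * p)).hom ⊓ A.hodgePQ (2 * p) p' q' →
    M.map (A.pullback (2 * p)).hom ⊓ A.hodgePQ (2 * p) (2 * p) 0 = ⊥ →
    W.map f ≤ M →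
    (∀ V : Submodule ℂ (complexBetti X (2 * p)),
      Submodule.span ℂ {x : complexBetti X (2 * p) | x ∈ V ∧ IsRationalClass x} = V →
      V.map (A.pullback (2 * p)).hom =
        ⨆ (p' : ℕ) (q' : ℕ) (_ : p' + q' = 2 * p), V.map (A.pullback (2 * p)).hom ⊓ A.hodgePQ (2 * p) p' q' →
      A.hodgePQ (2 * p) (2 * p) 0 ≤ V.map (A.pullback (2 * p)).hom →
      algebraicClasses X p ≤ V →
      LinearMap.range f ≤ V) →
    W.map f ≤ algebraicClasses X p := by
  intro p X hp hX A f W M hMrat hMsub hM0 hWM hV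
  -- (1) `Alg` is rationally spanned, of pure type `(p, p)`, sub-Hodge, without `(2p,0)`-part
  have hArat : Submodule.span ℂ
      {x : complexBetti X (2 * p) | x ∈ algebraicClasses X p ∧ IsRationalClass x} =
        algebraicClasses X p :=
    le_antisymm (Submodule.span_le.2 fun x hx ↦ hx.1)
      ((supportedClasses_eq_span_isRationalClass hX (2 * p) p).le.trans
        (Submodule.span_mono fun x hx ↦ ⟨hx.2, hx.1⟩))
  have hApp : ∀ a ∈ algebraicClasses X p, A.pullback (2 * p) a ∈ A.hodgePQ (2 * p) p p :=
    fun a ha ↦ (hodgePQ_independent_of_hodgeModel_holds.isOfHodgeType_iff hX A).1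
      (isOfHodgeType_of_mem_algebraicClasses_of_isSmoothProjective hX p ha)
  have hAsub : (algebraicClasses X p).map (A.pullback (2 * p)).hom =
      ⨆ (p' : ℕ) (q' : ℕ) (_ : p' + q' = 2 * p),
        (algebraicClasses X p).map (A.pullback (2 * p)).hom ⊓ A.hodgePQ (2 * p) p' q' := by
    refine (A.isSubHodge_iff_le (2 * p) _).2 ?_
    rintro _ ⟨a, ha, rfl⟩
    exact Submodule.mem_iSup_of_mem p (Submodule.mem_iSup_of_mem p
      (Submodule.mem_iSup_of_mem (two_mul p).symm ⟨Submodule.mem_map_of_mem ha, hApp a ha⟩))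
  have hA0 : (algebraicClasses X p).map (A.pullback (2 * p)).hom ⊓
      A.hodgePQ (2 * p) (2 * p) 0 = ⊥ := by
    rw [eq_bot_iff]
    rintro _ ⟨⟨a, ha, rfl⟩, hy⟩
    rw [Submodule.mem_bot]
    -- `A^* a ∈ H^{p,p} ⊓ H^{2p,0} = 0`, as `(p, p) ≠ (2p, 0)` for `p ≥ 1`
    have hne : (⟨(p, p), mem_antidiagonal.2 (two_mul p).symm⟩ : ↥(antidiagonal (2 * p))) ≠
        ⟨(2 * p, 0), mem_antidiagonal.2 (add_zero _)⟩ := fun h ↦ by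
      have h' : (p, p) = (2 * p, 0) := congrArg Subtype.val h
      simp only [Prod.mk.injEq] at h'
      omega
    have hdisj := (A.iSupIndep_hodgePQ (2 * p)).pairwiseDisjoint hne
    exact Submodule.disjoint_def.1 hdisj _ (hApp a ha) hy
  -- (2) `M₁ := M ⊔ Alg` is rationally spanned, sub-Hodge, without `(2p,0)`-part
  have hM₁rat := isotypicAlg_rat_sup hMrat hArat
  have hM₁sub := isotypicAlg_sub_sup A hMsub hAsub
  have hM₁0 : (M ⊔ algebraicClasses X p).map (A.pullback (2 * p)).hom ⊓
      A.hodgePQ (2 * p) (2 * p) 0 = ⊥ := by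
    rw [eq_bot_iff]
    refine (isotypicAlg_map_sup_inf_le A hMsub hAsub (add_zero (2 * p))).trans ?_
    rw [hM0, hA0, bot_sup_eq]
  -- (3) `⊤` is rationally spanned and sub-Hodge; complete reducibility
  have hTrat : Submodule.span ℂ {x : complexBetti X (2 * p) |
      x ∈ (⊤ : Submodule ℂ (complexBetti X (2 * p))) ∧ IsRationalClass x} = ⊤ :=
    eq_top_iff.2
      ((span_isRationalClass_eq_top_of_isSmoothProjective_holds (2 * p) X hX (2 * p)).ge.trans
        (Submodule.span_mono fun x hx ↦ ⟨Submodule.mem_top, hx⟩))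
  have hTsub : (⊤ : Submodule ℂ (complexBetti X (2 * p))).map (A.pullback (2 * p)).hom =
      ⨆ (p' : ℕ) (q' : ℕ) (_ : p' + q' = 2 * p),
        (⊤ : Submodule ℂ (complexBetti X (2 * p))).map (A.pullback (2 * p)).hom ⊓
          A.hodgePQ (2 * p) p' q' := by
    rw [Submodule.map_top, LinearMap.range_eq_top.2 (A.pullback_surjective (2 * p))]
    exact A.isSubHodge_top (2 * p)
  obtain ⟨M', hM'rat, hM'sub, hinf, hsup⟩ :=
    stub_completelyReducible smoothProjective_hodgeStructure_isPolarizable_holds hX A (2 * p)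
      (M ⊔ algebraicClasses X p) ⊤ hTrat hTsub hM₁rat hM₁sub le_top
  -- (4) `H^{2p,0} ≤ M₁'.map A^*`
  have h20 : A.hodgePQ (2 * p) (2 * p) 0 ≤ M'.map (A.pullback (2 * p)).hom := by
    intro h hh
    have hmem : h ∈ (M ⊔ algebraicClasses X p ⊔ M').map (A.pullback (2 * p)).hom ⊓
        A.hodgePQ (2 * p) (2 * p) 0 := by
      refine ⟨?_, hh⟩
      rw [hsup, Submodule.map_top, LinearMap.range_eq_top.2 (A.pullback_surjective (2 * p))]
      exact Submodule.mem_top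
    have h' := isotypicAlg_map_sup_inf_le A hM₁sub hM'sub (add_zero (2 * p)) hmem
    rw [hM₁0, bot_sup_eq] at h'
    exact (Submodule.mem_inf.1 h').1
  -- (5) `V := M₁' ⊔ Alg` qualifies: `im f ≤ M₁' ⊔ Alg`
  have hrange : LinearMap.range f ≤ M' ⊔ algebraicClasses X p :=
    hV _ (isotypicAlg_rat_sup hM'rat hArat) (isotypicAlg_sub_sup A hM'sub hAsub)
      (h20.trans (Submodule.map_mono le_sup_left)) le_sup_right
  -- (6) `f w = m' + a`, `m' = f w - a ∈ M₁ ⊓ M₁' = 0`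
  rintro _ ⟨w, hw, rfl⟩
  have hfw : f w ∈ M ⊔ algebraicClasses X p :=
    Submodule.mem_sup_left (hWM (Submodule.mem_map_of_mem hw))
  obtain ⟨m', hm', a, ha, hsum⟩ := Submodule.mem_sup.1 (hrange (LinearMap.mem_range_self f w))
  have hm'₁ : m' ∈ M ⊔ algebraicClasses X p := by
    have e : m' = f w - a := by rw [← hsum, add_sub_cancel_right]
    rw [e]
    exact Submodule.sub_mem _ hfw (Submodule.mem_sup_right ha)
  have hm'0 : m' = 0 := by
    rw [← Submodule.mem_bot ℂ, ← hinf]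
    exact ⟨hm'₁, hm'⟩
  rw [← hsum, hm'0, zero_add]
  exact ha

end Summit.HodgeConjecture.HodgeConjecture.Theorems

end
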